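import Summits.FinalStateConjecture.FinalStateConjecture.Theorems.UniformPhotonSphereChannels.Negative.ApproxConservation

/-!
# Crux `UniformPhotonSphereChannels` (K1), negative side — the energy flux through a ray
# `T = βX` (a tortoise time slice) in terms of the energy at an earlier Minkowski time

Support file of the standing disprover of item stmt-FinalStateConjecture-10045 (step (2)–(4) of the
Rindler-frame bound).  For a global `C²` solution `u` of `u_TT − u_XX + Wu = 0` (`W ∈ C¹`,
`W ≥ 0`) vanishing on `{Xr < X − |T|}`, `0 < β < 1`, `0 < T_lo ≤ T_hi`, `X_lo = T_lo/β`,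
`X_* = T_hi/β`, and a slowly varying potential (`W ≥ W_min`, `|∂_T W| ≤ D` between the ray and
the support, `(T_hi − T_lo) D ≤ W_min/2`):

`∫_{X_lo}^{X_*} (e + β m)(βX, X) dX ≤ ∫_{X_lo}^{X₂} e(T_lo, ·) + 4 (D/W_min)(T_hi − T_lo) ∫_{X_lo}^{B} e(T_lo, ·)`,

`X₂ = X_* + T_hi − T_lo`, `B = Xr + T_hi + 1` (`ray_flux_le`): the `WaveDefect` identity on
the region above the ray (`X ≥ T/β`), the backward domain of dependence from time `T_hi`, two
bootstraps, and the substitution `T = βX`.  The left side is the `T`-energy flux through the ray,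
which dominates the Regge–Wheeler energy of the time slice (`RayEnergy`); the two are combined
with the pinning bound in `HorizonEstimate`. [folklore]
-/

namespace Summit.FinalStateConjecture.FinalStateConjecture.Theorems

open MeasureTheory Set Filter Topology intervalIntegral

noncomputable section

namespace WaveDefect

open WaveEnergy

variable {u W : ℝ × ℝ → ℝ} {Xr : ℝ}

-- Heartbeat headroom (2026-08-16 full-build breakage): `ray_flux_le` elaborates in 100k–200k heartbeats
-- (farm probe: fails at 100000, passes at the default 200000; the 2026-08-16 full build timed out at 200000),
-- i.e. at the cap; doubled, proof unchanged.
set_option maxHeartbeats 400000 in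
/-- **Energy flux through the ray.** See the module docstring. -/
theorem ray_flux_le (hu : ContDiff ℝ 2 u) (hW : ContDiff ℝ 1 W) (hW0 : ∀ z, 0 ≤ W z)
    (hsol : ∀ z : ℝ × ℝ, fderiv ℝ (fderiv ℝ u) z (1, 0) (1, 0)
      - fderiv ℝ (fderiv ℝ u) z (0, 1) (0, 1) + W z * u z = 0)
    (hzeroR : ∀ z : ℝ × ℝ, Xr < z.2 - |z.1| → u z = 0)
    {β Tlo Thi Wmin D m₀ : ℝ} (hβ0 : 0 < β) (hβ1 : β < 1) (hTlo : 0 < Tlo) (hT : Tlo ≤ Thi)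
    (hWmin : 0 < Wmin) (hD : 0 ≤ D) (hm₀1 : m₀ ≤ Tlo * (1 - β) / β)
    (hm₀2 : m₀ ≤ Thi / β * (1 - β)) (hXs : Thi / β ≤ Xr)
    (hWK : ∀ z : ℝ × ℝ, z.1 ∈ Icc Tlo Thi → m₀ ≤ z.2 - z.1 → z.2 ≤ Xr + z.1 → Wmin ≤ W z)
    (hDK : ∀ z : ℝ × ℝ, z.1 ∈ Icc Tlo Thi → m₀ ≤ z.2 - z.1 → z.2 ≤ Xr + z.1 → |fderiv ℝ W z (1, 0)| ≤ D)
    (hsmall : (Thi - Tlo) * D ≤ Wmin / 2)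
    {e : ℝ × ℝ → ℝ}
    (he : ∀ z, e z = (fderiv ℝ u z (1, 0)) ^ 2 + (fderiv ℝ u z (0, 1)) ^ 2 + W z * u z ^ 2) :
    (∫ X in (Tlo / β)..(Thi / β), (e (β * X, X)
        + β * (2 * fderiv ℝ u (β * X, X) (1, 0) * fderiv ℝ u (β * X, X) (0, 1))))
      ≤ (∫ X in (Tlo / β)..(Thi / β + Thi - Tlo), e (Tlo, X))
        + 4 * (D / Wmin) * (Thi - Tlo) * ∫ X in (Tlo / β)..(Xr + Thi + 1), e (Tlo, X) := by
  set m : ℝ × ℝ → ℝ := fun z => 2 * fderiv ℝ u z (1, 0) * fderiv ℝ u z (0, 1) with hmdef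
  have hm : ∀ z, m z = 2 * fderiv ℝ u z (1, 0) * fderiv ℝ u z (0, 1) := fun z => rfl
  set F : ℝ × ℝ → ℝ := fun z => fderiv ℝ (fderiv ℝ u) z (1, 0) (1, 0)
      - fderiv ℝ (fderiv ℝ u) z (0, 1) (0, 1) + W z * u z with hFdef
  have hF : ∀ z, F z = fderiv ℝ (fderiv ℝ u) z (1, 0) (1, 0)
      - fderiv ℝ (fderiv ℝ u) z (0, 1) (0, 1) + W z * u z := fun z => rfl
  set B : ℝ := Xr + Thi + 1 with hB
  have hec : Continuous e := (differentiable_energyDensity hu (hW.differentiable (by norm_num)) he).continuous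
  have hmc : Continuous m := (differentiable_momentumDensity hu hm).continuous
  have he0 : ∀ z, 0 ≤ e z := energyDensity_nonneg hW0 he
  have hme : ∀ z, |m z| ≤ e z := fun z =>
    abs_le.mpr ⟨by linarith [neg_momentum_le_energy hW0 he hm z], momentum_le_energy hW0 he hm z⟩
  have hβle1 : β ≤ 1 := hβ1.le
  -- geometry
  have hXlo : 0 < Tlo / β := div_pos hTlo hβ0
  have hXloXs : Tlo / β ≤ Thi / β := div_le_div_of_nonneg_right hT hβ0.le
  -- vanishing at the far end `B` for times `t ≤ Thi`
  have hfar : ∀ t, |t| ≤ Thi → ∀ X, B ≤ X → u (t, X) = 0 ∧ fderiv ℝ u (t, X) = 0 := by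
    intro t ht X hX
    have hz : Xr < X - |t| := by rw [hB] at hX; linarith
    have hz' : Xr < ((t, X) : ℝ × ℝ).2 - |((t, X) : ℝ × ℝ).1| := by simpa using hz
    obtain ⟨h1, h2, -⟩ := vanish_right hzeroR hz'
    exact ⟨h1, h2⟩
  have hmB : ∀ t, |t| ≤ Thi → m (t, B) = 0 := fun t ht => by
    simp [hm, (hfar t ht B le_rfl).2]
  have heB0 : ∀ t, |t| ≤ Thi → ∀ X, B ≤ X → e (t, X) = 0 := fun t ht X hX => by
    obtain ⟨h1, h2⟩ := hfar t ht X hX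
    simp [he, h1, h2]
  -- pointwise source bound on the region above the ray / inside the backward domain
  have hsrc : ∀ t ∈ Icc Tlo Thi, ∀ X, m₀ ≤ X - t →
      2 * fderiv ℝ u (t, X) (1, 0) * F (t, X) + fderiv ℝ W (t, X) (1, 0) * u (t, X) ^ 2
        ≤ D / Wmin * e (t, X) := by
    intro t ht X hX
    rw [hF, hsol (t, X), mul_zero, zero_add]
    by_cases hK : X ≤ Xr + t
    · have hW1 := hWK (t, X) ht hX hK
      have hD1 := hDK (t, X) ht hX hK
      have hu2' : Wmin * u (t, X) ^ 2 ≤ e (t, X) := by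
        rw [he]
        nlinarith [sq_nonneg (fderiv ℝ u (t, X) (1, 0)), sq_nonneg (fderiv ℝ u (t, X) (0, 1)),
          mul_le_mul_of_nonneg_right hW1 (sq_nonneg (u (t, X)))]
      have h3 : fderiv ℝ W (t, X) (1, 0) * u (t, X) ^ 2 ≤ D * u (t, X) ^ 2 :=
        mul_le_mul_of_nonneg_right (le_of_abs_le hD1) (sq_nonneg _)
      have h4 : D * u (t, X) ^ 2 ≤ D / Wmin * e (t, X) := by
        rw [div_mul_eq_mul_div, le_div_iff₀ hWmin]
        nlinarith [mul_le_mul_of_nonneg_left hu2' hD]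
      linarith
    · push Not at hK
      have hz : u (t, X) = 0 := hzeroR (t, X) (by simp only; rw [abs_of_nonneg (by linarith [ht.1])]; linarith)
      rw [hz]
      have := he0 (t, X)
      have : 0 ≤ D / Wmin * e (t, X) := by positivity
      simpa using this
  -- (a) the energy above the ray, `E_R(T) = ∫_{T/β}^{B} e(T, ·)`, and the flux `Φ`
  set ER : ℝ → ℝ := fun T => ∫ X in (T / β)..B, e (T, X) with hER
  set Φ : ℝ → ℝ := fun T => ∫ t in Tlo..T, (m (t, t / β) + e (t, t / β) / β) with hΦ
  have hERc : Continuous ER := by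
    have h1 : Continuous fun p : ℝ × ℝ => e (p.1, p.2) := hec.comp (continuous_fst.prodMk continuous_snd)
    have := intervalIntegral.continuous_parametric_intervalIntegral_of_continuous (μ := volume) (f := fun T X => e (T, X))
      (a₀ := B) (by exact h1) (s := fun T => T / β) (by fun_prop)
    -- `∫_{T/β}^{B} = -∫_{B}^{T/β}`
    have heq : ER = fun T => -∫ X in B..(T / β), e (T, X) := by
      funext T; simp only [hER]; rw [intervalIntegral.integral_symm]
    rw [heq]; exact this.neg
  have hidR : ∀ T ∈ Icc Tlo Thi, ER T - ER Tlo = -Φ T + ∫ t in Tlo..T, ∫ X in (t / β)..B,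
      (2 * fderiv ℝ u (t, X) (1, 0) * F (t, X) + fderiv ℝ W (t, X) (1, 0) * u (t, X) ^ 2) := by
    intro T hTT
    have key := energy_identity_affine_source hu hW he hm hF 0 β⁻¹ B 0 Tlo T
    simp only [zero_add, zero_mul, add_zero] at key
    have e1 : ∀ t : ℝ, β⁻¹ * t = t / β := fun t => by rw [inv_mul_eq_div]
    simp only [e1] at key
    have hbd : (∫ t in Tlo..T, (m (t, B) - (m (t, t / β) + e (t, t / β) / β)))
        = -Φ T := by
      simp only [hΦ]
      rw [← intervalIntegral.integral_neg]
      refine intervalIntegral.integral_congr fun t ht => ?_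
      rw [uIcc_of_le hTT.1] at ht
      have : |t| ≤ Thi := by rw [abs_of_nonneg (by linarith [ht.1])]; exact ht.2.trans hTT.2
      simp [hmB t this]
    rw [hbd] at key
    simpa [hER] using key
  -- `Φ ≥ 0` and monotone pieces
  have hΦint : ∀ t, 0 ≤ m (t, t / β) + e (t, t / β) / β := by
    intro t
    have h1 := hme (t, t / β)
    have h2 : e (t, t / β) ≤ e (t, t / β) / β := by
      rw [le_div_iff₀ hβ0]; nlinarith [he0 (t, t / β)]
    linarith [neg_abs_le (m (t, t / β))]
  -- source bound in terms of `ER`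
  have hsrcR : ∀ T ∈ Icc Tlo Thi, (∫ t in Tlo..T, ∫ X in (t / β)..B,
      (2 * fderiv ℝ u (t, X) (1, 0) * F (t, X) + fderiv ℝ W (t, X) (1, 0) * u (t, X) ^ 2))
      ≤ D / Wmin * ∫ t in Tlo..T, ER t := by
    intro T hTT
    have hsc : Continuous fun p : ℝ × ℝ => 2 * fderiv ℝ u p (1, 0) * F p + fderiv ℝ W p (1, 0) * u p ^ 2 := by
      have h1 := continuous_fderiv_apply hu (1, 0)
      have h2 := continuous_defect hu hW.continuous hF
      have h3 : Continuous fun p : ℝ × ℝ => fderiv ℝ W p (1, 0) :=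
        (hW.continuous_fderiv (by norm_num)).clm_apply continuous_const
      exact ((continuous_const.mul h1).mul h2).add (h3.mul (hu.continuous.pow 2))
    rw [← intervalIntegral.integral_const_mul]
    refine intervalIntegral.integral_mono_on hTT.1 ?_ ?_ fun t ht => ?_
    · have h1 : Continuous fun p : ℝ × ℝ => 2 * fderiv ℝ u (p.1, p.2) (1, 0) * F (p.1, p.2)
          + fderiv ℝ W (p.1, p.2) (1, 0) * u (p.1, p.2) ^ 2 := hsc.comp (continuous_fst.prodMk continuous_snd)
      have := intervalIntegral.continuous_parametric_intervalIntegral_of_continuous (μ := volume)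
        (f := fun t X => 2 * fderiv ℝ u (t, X) (1, 0) * F (t, X) + fderiv ℝ W (t, X) (1, 0) * u (t, X) ^ 2)
        (a₀ := B) (by exact h1) (s := fun t => t / β) (by fun_prop)
      have heq : (fun t => ∫ X in (t / β)..B, (2 * fderiv ℝ u (t, X) (1, 0) * F (t, X)
          + fderiv ℝ W (t, X) (1, 0) * u (t, X) ^ 2))
          = fun t => -∫ X in B..(t / β), (2 * fderiv ℝ u (t, X) (1, 0) * F (t, X)
            + fderiv ℝ W (t, X) (1, 0) * u (t, X) ^ 2) := by
        funext t; rw [intervalIntegral.integral_symm]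
      rw [heq]; exact this.neg.intervalIntegrable _ _
    · exact (continuous_const.mul hERc).intervalIntegrable _ _
    · have ht' : t ∈ Icc Tlo Thi := ⟨ht.1, ht.2.trans hTT.2⟩
      simp only [hER]
      rw [← intervalIntegral.integral_const_mul]
      have htβ : t / β ≤ B := by
        have : t / β ≤ Thi / β := div_le_div_of_nonneg_right ht'.2 hβ0.le
        rw [hB]; linarith [hT]
      refine intervalIntegral.integral_mono_on htβ ?_ ?_ fun X hX => hsrc t ht' X ?_
      · exact (hsc.comp (Continuous.prodMk_right t)).intervalIntegrable _ _
      · exact (continuous_const.mul (hec.comp (Continuous.prodMk_right t))).intervalIntegrable _ _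
      · -- `X ≥ t/β` ⇒ `X − t ≥ t(1−β)/β ≥ Tlo(1−β)/β ≥ m₀`
        have h1 : t / β - t = t * (1 - β) / β := by field_simp
        have h2 : Tlo * (1 - β) / β ≤ t * (1 - β) / β :=
          div_le_div_of_nonneg_right (mul_le_mul_of_nonneg_right ht'.1 (by linarith)) hβ0.le
        linarith [hX.1]
  have hTB : ∀ T ∈ Icc Tlo Thi, T / β ≤ B := fun T hTT => by
    have : T / β ≤ Thi / β := div_le_div_of_nonneg_right hTT.2 hβ0.le
    rw [hB]; linarith [hT]
  have hER0 : ∀ T ∈ Icc Tlo Thi, 0 ≤ ER T := fun T hTT =>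
    intervalIntegral.integral_nonneg (hTB T hTT) fun X _ => he0 _
  have hΦ0 : ∀ T ∈ Icc Tlo Thi, 0 ≤ Φ T := fun T hTT =>
    intervalIntegral.integral_nonneg hTT.1 fun t _ => hΦint t
  -- (a) bootstrap for `ER`
  have hineqR : ∀ T ∈ Icc Tlo Thi, ER T ≤ ER Tlo + D / Wmin * ∫ t in Tlo..T, ER t := by
    intro T hTT
    have h1 := hidR T hTT
    have h2 := hsrcR T hTT
    have h3 := hΦ0 T hTT
    linarith
  have hERb : ∀ T ∈ Icc Tlo Thi, ER T ≤ 2 * ER Tlo := by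
    -- shift time: `s = T − Tlo ∈ [0, Thi − Tlo]`
    have hboot := bootstrap_le_two_mul (E := fun s => ER (Tlo + s)) (T₁ := Thi - Tlo) (a := ER Tlo)
      (k := D / Wmin) (by linarith) ((hERc.comp (continuous_const.add continuous_id)).continuousOn)
      (fun s hs => hER0 (Tlo + s) ⟨by linarith [hs.1], by linarith [hs.2]⟩) (by positivity)
      (by rw [div_mul_eq_mul_div, div_le_iff₀ hWmin]; linarith) ?_
    · intro T hTT
      have := hboot (T - Tlo) ⟨by linarith [hTT.1], by linarith [hTT.2]⟩
      simpa using this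
    · intro s hs
      have hTs : Tlo + s ∈ Icc Tlo Thi := ⟨by linarith [hs.1], by linarith [hs.2]⟩
      have h1 := hineqR (Tlo + s) hTs
      have hshift : ∫ t in Tlo..(Tlo + s), ER t = ∫ t in (0 : ℝ)..s, ER (Tlo + t) := by
        rw [intervalIntegral.integral_comp_add_left (fun t => ER t) Tlo]
        simp
      rw [hshift] at h1
      simpa using h1
  -- flux through the ray in terms of `ER`
  have hThi : Thi ∈ Icc Tlo Thi := ⟨hT, le_rfl⟩
  have hΦThi : Φ Thi ≤ ER Tlo - ER Thi + D / Wmin * ((Thi - Tlo) * (2 * ER Tlo)) := by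
    have h1 := hidR Thi hThi
    have h2 := hsrcR Thi hThi
    have h3 : ∫ t in Tlo..Thi, ER t ≤ (Thi - Tlo) * (2 * ER Tlo) := by
      have : ∫ t in Tlo..Thi, ER t ≤ ∫ t in Tlo..Thi, 2 * ER Tlo :=
        intervalIntegral.integral_mono_on hT (hERc.intervalIntegrable _ _)
          _root_.intervalIntegrable_const fun t ht => hERb t ht
      rw [intervalIntegral.integral_const, smul_eq_mul] at this
      linarith
    have h4 := mul_le_mul_of_nonneg_left h3 (by positivity : 0 ≤ D / Wmin)
    linarith
  -- (b) backward domain of dependence from `Thi` down to `Tlo`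
  set c₀ : ℝ := Thi / β + Thi with hc₀
  set E' : ℝ → ℝ := fun T => ∫ X in (c₀ - T)..B, e (T, X) with hE'
  have hE'Thi : E' Thi = ER Thi := by simp only [hE', hER, hc₀]; congr 1; ring
  have hidR' := energy_identity_affine_source hu hW he hm hF c₀ (-1) B 0 Tlo Thi
  simp only [zero_mul, add_zero] at hidR'
  have ec : ∀ t : ℝ, c₀ + -1 * t = c₀ - t := fun t => by ring
  simp only [ec] at hidR'
  have hbd' : 0 ≤ ∫ t in Tlo..Thi, (m (t, B) - (m (t, c₀ - t) + -1 * e (t, c₀ - t))) := by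
    refine intervalIntegral.integral_nonneg hT fun t ht => ?_
    have : |t| ≤ Thi := by rw [abs_of_nonneg (by linarith [ht.1])]; exact ht.2
    rw [hmB t this]
    have := hme (t, c₀ - t)
    linarith [le_abs_self (m (t, c₀ - t))]
  have hsrc' : -(D / Wmin * ((Thi - Tlo) * (2 * ER Tlo))) ≤ ∫ t in Tlo..Thi, ∫ X in (c₀ - t)..B,
      (2 * fderiv ℝ u (t, X) (1, 0) * F (t, X) + fderiv ℝ W (t, X) (1, 0) * u (t, X) ^ 2) := by
    -- bound the source from above in absolute value by `(D/Wmin) ∫ E' ≤ (D/Wmin)(Thi−Tlo)·2ER(Tlo)`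
    have hsc : Continuous fun p : ℝ × ℝ => 2 * fderiv ℝ u p (1, 0) * F p + fderiv ℝ W p (1, 0) * u p ^ 2 := by
      have h1 := continuous_fderiv_apply hu (1, 0)
      have h2 := continuous_defect hu hW.continuous hF
      have h3 : Continuous fun p : ℝ × ℝ => fderiv ℝ W p (1, 0) :=
        (hW.continuous_fderiv (by norm_num)).clm_apply continuous_const
      exact ((continuous_const.mul h1).mul h2).add (h3.mul (hu.continuous.pow 2))
    -- pointwise: the source is ≥ −(D/Wmin) e (it is ≤ (D/Wmin)e in absolute value)
    have hsrc2 : ∀ t ∈ Icc Tlo Thi, ∀ X, m₀ ≤ X - t →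
        -(D / Wmin * e (t, X)) ≤ 2 * fderiv ℝ u (t, X) (1, 0) * F (t, X)
          + fderiv ℝ W (t, X) (1, 0) * u (t, X) ^ 2 := by
      intro t ht X hX
      rw [hF, hsol (t, X), mul_zero, zero_add]
      by_cases hK : X ≤ Xr + t
      · have hW1 := hWK (t, X) ht hX hK
        have hD1 := hDK (t, X) ht hX hK
        have hu2' : Wmin * u (t, X) ^ 2 ≤ e (t, X) := by
          rw [he]
          nlinarith [sq_nonneg (fderiv ℝ u (t, X) (1, 0)), sq_nonneg (fderiv ℝ u (t, X) (0, 1)),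
            mul_le_mul_of_nonneg_right hW1 (sq_nonneg (u (t, X)))]
        have h3 : -(D * u (t, X) ^ 2) ≤ fderiv ℝ W (t, X) (1, 0) * u (t, X) ^ 2 := by
          have := mul_le_mul_of_nonneg_right (neg_le_of_abs_le hD1) (sq_nonneg (u (t, X)))
          linarith
        have h4 : D * u (t, X) ^ 2 ≤ D / Wmin * e (t, X) := by
          rw [div_mul_eq_mul_div, le_div_iff₀ hWmin]
          nlinarith [mul_le_mul_of_nonneg_left hu2' hD]
        linarith
      · push Not at hK
        have hz : u (t, X) = 0 := hzeroR (t, X) (by simp only; rw [abs_of_nonneg (by linarith [ht.1])]; linarith)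
        rw [hz]
        have := he0 (t, X)
        have : 0 ≤ D / Wmin * e (t, X) := by positivity
        simp; linarith
    have hE'c : Continuous E' := by
      have h1 : Continuous fun p : ℝ × ℝ => e (p.1, p.2) := hec.comp (continuous_fst.prodMk continuous_snd)
      have := intervalIntegral.continuous_parametric_intervalIntegral_of_continuous (μ := volume)
        (f := fun T X => e (T, X)) (a₀ := B) (by exact h1) (s := fun T => c₀ - T) (by fun_prop)
      have heq : E' = fun T => -∫ X in B..(c₀ - T), e (T, X) := by
        funext T; simp only [hE']; rw [intervalIntegral.integral_symm]
      rw [heq]; exact this.neg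
    have hlow : ∫ t in Tlo..Thi, -(D / Wmin * E' t) ≤ ∫ t in Tlo..Thi, ∫ X in (c₀ - t)..B,
        (2 * fderiv ℝ u (t, X) (1, 0) * F (t, X) + fderiv ℝ W (t, X) (1, 0) * u (t, X) ^ 2) := by
      refine intervalIntegral.integral_mono_on hT ((continuous_const.mul hE'c).neg.intervalIntegrable _ _) ?_
        fun t ht => ?_
      · have h1 : Continuous fun p : ℝ × ℝ => 2 * fderiv ℝ u (p.1, p.2) (1, 0) * F (p.1, p.2)
            + fderiv ℝ W (p.1, p.2) (1, 0) * u (p.1, p.2) ^ 2 := hsc.comp (continuous_fst.prodMk continuous_snd)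
        have := intervalIntegral.continuous_parametric_intervalIntegral_of_continuous (μ := volume)
          (f := fun t X => 2 * fderiv ℝ u (t, X) (1, 0) * F (t, X) + fderiv ℝ W (t, X) (1, 0) * u (t, X) ^ 2)
          (a₀ := B) (by exact h1) (s := fun t => c₀ - t) (by fun_prop)
        have heq : (fun t => ∫ X in (c₀ - t)..B, (2 * fderiv ℝ u (t, X) (1, 0) * F (t, X)
            + fderiv ℝ W (t, X) (1, 0) * u (t, X) ^ 2))
            = fun t => -∫ X in B..(c₀ - t), (2 * fderiv ℝ u (t, X) (1, 0) * F (t, X)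
              + fderiv ℝ W (t, X) (1, 0) * u (t, X) ^ 2) := by
          funext t; rw [intervalIntegral.integral_symm]
        rw [heq]; exact this.neg.intervalIntegrable _ _
      · simp only [hE']
        have hct : c₀ - t ≤ B := by
          rw [hc₀, hB]; have : Thi / β ≤ Xr := hXs; linarith [ht.1, hTlo]
        rw [← intervalIntegral.integral_const_mul, ← intervalIntegral.integral_neg]
        refine intervalIntegral.integral_mono_on hct ?_ ?_ fun X hX => hsrc2 t ht X ?_
        · exact ((continuous_const.mul (hec.comp (Continuous.prodMk_right t))).neg).intervalIntegrable _ _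
        · exact (hsc.comp (Continuous.prodMk_right t)).intervalIntegrable _ _
        · -- `X ≥ c₀ − t ≥ Thi/β + Thi − 2 Thi... ≥ Thi/β − Thi = X_*(1−β) ≥ m₀`
          have h1 : Thi / β * (1 - β) = Thi / β - Thi := by
            rw [mul_sub, mul_one, div_mul_cancel₀ _ hβ0.ne']
          rw [hc₀] at hX
          linarith [hX.1, ht.2, hm₀2]
    have hE'le : ∀ t ∈ Icc Tlo Thi, E' t ≤ ER t := by
      intro t ht
      simp only [hE', hER]
      have h1 : t / β ≤ c₀ - t := by
        rw [hc₀]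
        have : t / β ≤ Thi / β := div_le_div_of_nonneg_right ht.2 hβ0.le
        have h2 : t + t / β ≤ Thi + Thi / β := by linarith [ht.2]
        linarith
      have h2 : c₀ - t ≤ B := by rw [hc₀, hB]; have : Thi / β ≤ Xr := hXs; linarith [ht.1, hTlo]
      exact intervalIntegral.integral_mono_interval h1 h2 le_rfl
        (Filter.Eventually.of_forall fun X => he0 _)
        ((hec.comp (Continuous.prodMk_right t)).intervalIntegrable _ _)
    have hint : ∫ t in Tlo..Thi, -(D / Wmin * E' t) ≥ -(D / Wmin * ((Thi - Tlo) * (2 * ER Tlo))) := by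
      have h1 : ∫ t in Tlo..Thi, -(D / Wmin * (2 * ER Tlo)) ≤ ∫ t in Tlo..Thi, -(D / Wmin * E' t) := by
        refine intervalIntegral.integral_mono_on hT _root_.intervalIntegrable_const
          ((continuous_const.mul hE'c).neg.intervalIntegrable _ _) fun t ht => ?_
        have h3 := (hE'le t ht).trans (hERb t ht)
        have hk : 0 ≤ D / Wmin := by positivity
        have := mul_le_mul_of_nonneg_left h3 hk
        linarith
      rw [intervalIntegral.integral_const, smul_eq_mul] at h1
      have e4 : (Thi - Tlo) * -(D / Wmin * (2 * ER Tlo)) = -(D / Wmin * ((Thi - Tlo) * (2 * ER Tlo))) := by ring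
      linarith [h1, e4]
    linarith
  have hE'Tlo : E' Tlo = ∫ X in (Thi / β + Thi - Tlo)..B, e (Tlo, X) := by
    simp only [hE', hc₀]
  have hlowR' : (∫ X in (Thi / β + Thi - Tlo)..B, e (Tlo, X)) - D / Wmin * ((Thi - Tlo) * (2 * ER Tlo))
      ≤ ER Thi := by
    have : E' Thi - E' Tlo = (∫ t in Tlo..Thi, (m (t, B) - (m (t, c₀ - t) + -1 * e (t, c₀ - t))))
        + ∫ t in Tlo..Thi, ∫ X in (c₀ - t)..B,
          (2 * fderiv ℝ u (t, X) (1, 0) * F (t, X) + fderiv ℝ W (t, X) (1, 0) * u (t, X) ^ 2) := hidR'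
    rw [hE'Thi, hE'Tlo] at this
    linarith [hbd', hsrc']
  -- (c) combine: `Φ(Thi) ≤ ∫_{X_lo}^{X₂} e(Tlo) + 4 (D/Wmin)(Thi − Tlo) ER(Tlo)`
  have hsplit : ER Tlo = (∫ X in (Tlo / β)..(Thi / β + Thi - Tlo), e (Tlo, X))
      + ∫ X in (Thi / β + Thi - Tlo)..B, e (Tlo, X) := by
    simp only [hER]
    rw [intervalIntegral.integral_add_adjacent_intervals]
    · exact (hec.comp (Continuous.prodMk_right Tlo)).intervalIntegrable _ _
    · exact (hec.comp (Continuous.prodMk_right Tlo)).intervalIntegrable _ _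
  have hΦfin : Φ Thi ≤ (∫ X in (Tlo / β)..(Thi / β + Thi - Tlo), e (Tlo, X))
      + 4 * (D / Wmin) * (Thi - Tlo) * ER Tlo := by
    have h1 := hΦThi
    have h2 := hlowR'
    rw [hsplit] at h1 h2 ⊢
    nlinarith [h1, h2, hER0 Tlo ⟨le_rfl, hT⟩]
  -- (d) the flux is the substitution `T = βX` of the ray integral
  have hΦray : (∫ X in (Tlo / β)..(Thi / β), (e (β * X, X) + β * m (β * X, X))) = Φ Thi := by
    simp only [hΦ]
    have key := intervalIntegral.integral_comp_mul_left
      (fun t => m (t, t / β) + e (t, t / β) / β) (c := β) hβ0.ne' (a := Tlo / β) (b := Thi / β)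
    have e1 : β * (Tlo / β) = Tlo := mul_div_cancel₀ _ hβ0.ne'
    have e2 : β * (Thi / β) = Thi := mul_div_cancel₀ _ hβ0.ne'
    rw [e1, e2] at key
    have e3 : ∀ X, β * X / β = X := fun X => by field_simp
    simp only [e3] at key
    -- `∫ (e + β m)(βX, X) dX = β · ∫ (m + β⁻¹ e)(βX, X) dX = β · β⁻¹ Φ`
    have : (fun X => e (β * X, X) + β * m (β * X, X)) = fun X => β * (m (β * X, X) + e (β * X, X) / β) := by
      funext X; field_simp; ring
    rw [this, intervalIntegral.integral_const_mul, key, smul_eq_mul, ← mul_assoc, mul_inv_cancel₀ hβ0.ne', one_mul]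
  simp only [hm] at hΦray
  rw [show (∫ X in (Tlo / β)..(Thi / β), (e (β * X, X)
      + β * (2 * fderiv ℝ u (β * X, X) (1, 0) * fderiv ℝ u (β * X, X) (0, 1)))) = Φ Thi from hΦray]
  exact hΦfin

end WaveDefect

end

end Summit.FinalStateConjecture.FinalStateConjecture.Theorems
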